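import Mathlib
import Summits.ValiantsHypothesis.ValiantsHypothesis.Theorems.ValuativeGCTValuativeFlipFourRowTransfer
import Summits.ValiantsHypothesis.ValiantsHypothesis.Theorems.ValuativeGCTValuativeFlipDegenerationStep

/-!
# Pencil certificates are monotone in the inner size (crux `ValuativeGCT.ValuativeFlip`,
# stmt-ValiantsHypothesis-12624; line `four-row-count`, stub `stub_fourRowPencilRank`; wall-breaker k5 gen 1)

Helper file (`--supports stmt-ValiantsHypothesis-12624`).  The per-side heart of the head of the crux is,
by `fourRowPencilRank_of_pencilCertificate` (`…FourRowTransfer`), the `m`-free hypothesis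

  `H : ∃ n₀, ∀ n ≥ n₀, ∃ M c, IsUnit (cells) ∧ 2⌊6n/5⌋² + ⌊6n/5⌋ + 2 ≤ finrank (pencilSpan ℂ n M)`,

`pencilSpan K n M = span{X_t · (∂_{ij} per_n)(M·X)}` for a four-variable pencil `M` of `n × n` linear
forms (`pencilSpan` unfolds by `rfl` to the expression in `H`).  This file proves that such certificates
are MONOTONE IN `n`: the block sum `M ⊕ (y₀)` of size `n + 1` keeps the four cells, and its cofactors
inside the old block are `y₀ ·` the old cofactors (`hb_generator_castSucc_castSucc_of_lastRow`, k1 gen 1),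
so the new span contains `y₀ · (old span)`, an injective image.  Consequences packaged for the routes to
`H` (the cyclic tridiagonal pencil of `Cruxes/ValuativeFlip/AxisK9G1a2CyclicTridiagonal.md`, whose proof
runs over ODD `n` and takes "`(n-1)`-pencil ⊕ 1×1 block" for even `n`; the Hessenberg pencil `HB_n`;
affine border ranks):

* `pencilSpan_finrank_le_succ`, `pencilCert_succ`, `pencilCert_of_le` — size `n` to every `n' ≥ n`;
* `pencilCert_eventually_of_frequently` — certificates on a cofinal set of sizes, with slack, give
  certificates at every large size;
* `pencilCert_of_odd` — certificates at all large ODD sizes of strength `B n` with `T n ≤ B n`,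
  `T n ≤ B (n-1)` give strength `T n` at every large `n`;
* `fourRowPencilRank_of_pencilCert_odd` — hence the registered skeleton stub `stub_fourRowPencilRank`
  VERBATIM from odd-size certificates and two arithmetic inequalities.

All folklore (Laplace expansion; Minc, *Permanents* (1978) §1.2); nothing here is specific to a pencil.
-/

set_option linter.dupNamespace false

namespace Summit.ValiantsHypothesis.ValiantsHypothesis.Theorems.ValuativeFlip

open MvPolynomial
open scoped BigOperators Matrix
open Literature.NumberTheory.DiophantineGeometry
open Literature.Computability.AlgebraicComplexity

noncomputable section

/-- The **pencil span** of a four-variable pencil `M` of `n × n` linear forms: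
`span{X_t · (∂_{ij} per_n)(M·X) : t, i, j} ⊆ K[X₀..X₃]` — the `m`-free form of the four-row tangent span
of line `four-row-count` (unfolds by `rfl` to the expression in `fourRowPencilRank_of_pencilCertificate`).
[this crux, line four-row-count] -/
def pencilSpan (K : Type*) [Field K] (n : ℕ) (M : Fin n × Fin n → Fin 4 → K) :
    Submodule K (MvPolynomial (Fin 4) K) :=
  Submodule.span K (Set.range fun tc : Fin 4 × (Fin n × Fin n) =>
    (X tc.1 : MvPolynomial (Fin 4) K) *
      aeval (fun ij : Fin n × Fin n => ∑ t : Fin 4, M ij t • (X t : MvPolynomial (Fin 4) K))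
        (pderiv tc.2 (perPoly (Fin n) K)))

/-- The block sum `M ⊕ (y₀)`: the old pencil in the top-left `(N+1) × (N+1)` block, the form `y₀` in
the new corner, zero elsewhere in the last row and the last column. [folklore] -/
def pcmExt {K : Type*} [Field K] {N : ℕ} (M : Fin (N + 1) × Fin (N + 1) → Fin 4 → K) :
    Fin (N + 2) × Fin (N + 2) → Fin 4 → K := fun q =>
  if h₁ : q.1 = Fin.last (N + 1) then (if q.2 = Fin.last (N + 1) then Pi.single 0 1 else 0)
  else if h₂ : q.2 = Fin.last (N + 1) then 0 else M (q.1.castPred h₁, q.2.castPred h₂)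

section lemmas

variable {K : Type*} [Field K] {N : ℕ}

/-- The pencil span is finite-dimensional (finitely many generators). [trivial] -/
instance pencilSpan_finite (n : ℕ) (M : Fin n × Fin n → Fin 4 → K) :
    Module.Finite K ↥(pencilSpan K n M) :=
  Module.Finite.span_of_finite K (Set.finite_range _)

/-- Inside the old block the block sum is the old pencil. [folklore] -/
@[simp] theorem pcmExt_castSucc_castSucc (M : Fin (N + 1) × Fin (N + 1) → Fin 4 → K)
    (i j : Fin (N + 1)) : pcmExt M (Fin.castSucc i, Fin.castSucc j) = M (i, j) := by
  simp [pcmExt, (Fin.castSucc_lt_last i).ne, (Fin.castSucc_lt_last j).ne]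

/-- The last row of the block sum vanishes off the corner. [folklore] -/
@[simp] theorem pcmExt_last_castSucc (M : Fin (N + 1) × Fin (N + 1) → Fin 4 → K) (j : Fin (N + 1)) :
    pcmExt M (Fin.last (N + 1), Fin.castSucc j) = 0 := by
  simp [pcmExt, (Fin.castSucc_lt_last j).ne]

/-- The corner of the block sum carries `y₀`. [folklore] -/
@[simp] theorem pcmExt_last_last (M : Fin (N + 1) × Fin (N + 1) → Fin 4 → K) :
    pcmExt M (Fin.last (N + 1), Fin.last (N + 1)) = Pi.single 0 1 := by
  simp [pcmExt]

/-- The linear-form point of the block sum: the last row is zero off the corner. [folklore] -/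
theorem pcmExt_point_last_castSucc (M : Fin (N + 1) × Fin (N + 1) → Fin 4 → K) (j : Fin (N + 1)) :
    (fun q : Fin (N + 2) × Fin (N + 2) => ∑ t : Fin 4, pcmExt M q t • (X t : MvPolynomial (Fin 4) K))
      (Fin.last (N + 1), Fin.castSucc j) = 0 := by
  simp

/-- The linear-form point of the block sum: the corner is `X 0`. [folklore] -/
theorem pcmExt_point_last_last (M : Fin (N + 1) × Fin (N + 1) → Fin 4 → K) :
    (∑ t : Fin 4, pcmExt M (Fin.last (N + 1), Fin.last (N + 1)) t • (X t : MvPolynomial (Fin 4) K)) =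
      X 0 := by
  simp [Pi.single_apply]

/-- The linear-form point of the block sum restricted to the old block is the old point. [folklore] -/
theorem pcmExt_point_castSucc (M : Fin (N + 1) × Fin (N + 1) → Fin 4 → K) :
    (fun q : Fin (N + 1) × Fin (N + 1) =>
      ∑ t : Fin 4, pcmExt M (Fin.castSucc q.1, Fin.castSucc q.2) t • (X t : MvPolynomial (Fin 4) K)) =
    fun ij : Fin (N + 1) × Fin (N + 1) => ∑ t : Fin 4, M ij t • (X t : MvPolynomial (Fin 4) K) := by
  funext q
  simp

/-- **Old generators reappear multiplied by `y₀`.**  For old `k, l`: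
`X_t · (∂_{kl} per_{N+2})((M ⊕ y₀)·X) = X 0 · (X_t · (∂_{kl} per_{N+1})(M·X))`. [folklore] -/
theorem pcmExt_generator (M : Fin (N + 1) × Fin (N + 1) → Fin 4 → K) (t : Fin 4) (k l : Fin (N + 1)) :
    (X t : MvPolynomial (Fin 4) K) *
        aeval (fun q : Fin (N + 2) × Fin (N + 2) => ∑ s : Fin 4, pcmExt M q s • (X s : MvPolynomial (Fin 4) K))
          (pderiv (Fin.castSucc k, Fin.castSucc l) (perPoly (Fin (N + 2)) K)) =
      X 0 * ((X t : MvPolynomial (Fin 4) K) *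
        aeval (fun ij : Fin (N + 1) × Fin (N + 1) => ∑ s : Fin 4, M ij s • (X s : MvPolynomial (Fin 4) K))
          (pderiv (k, l) (perPoly (Fin (N + 1)) K))) := by
  rw [hb_generator_castSucc_castSucc_of_lastRow _ (pcmExt_point_last_castSucc M) (X t) k l]
  -- `hb_generator…` produces the corner value and the restricted point in beta-reduced form
  rw [pcmExt_point_last_last, pcmExt_point_castSucc]

/-- The four cells keep their forms in the block sum. [trivial] -/
theorem pcmExt_cells (M : Fin (N + 1) × Fin (N + 1) → Fin 4 → K) (c : Fin 4 → Fin (N + 1) × Fin (N + 1)) :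
    (Matrix.of fun t t' : Fin 4 => pcmExt M (Fin.castSucc (c t').1, Fin.castSucc (c t').2) t) =
      Matrix.of fun t t' : Fin 4 => M (c t') t := by
  ext t t'
  simp

/-- **The span grows along the block sum**: `finrank (pencilSpan (N+1) M) ≤ finrank (pencilSpan (N+2) (M ⊕ y₀))`,
since the latter contains `X 0 · pencilSpan (N+1) M`, an injective image. [folklore; this crux] -/
theorem pencilSpan_finrank_le_succ (M : Fin (N + 1) × Fin (N + 1) → Fin 4 → K) :
    Module.finrank K ↥(pencilSpan K (N + 1) M) ≤ Module.finrank K ↥(pencilSpan K (N + 2) (pcmExt M)) := by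
  classical
  let μ : MvPolynomial (Fin 4) K →ₗ[K] MvPolynomial (Fin 4) K := LinearMap.mulLeft K (X 0)
  have hμ : Function.Injective μ := fun a b hab => by
    simpa [μ] using (mul_right_injective₀ (X_ne_zero (0 : Fin 4)) hab : a = b)
  have hle : (pencilSpan K (N + 1) M).map μ ≤ pencilSpan K (N + 2) (pcmExt M) := by
    unfold pencilSpan
    rw [Submodule.map_span_le]
    rintro _ ⟨⟨t, k, l⟩, rfl⟩
    refine Submodule.subset_span ⟨(t, (Fin.castSucc k, Fin.castSucc l)), ?_⟩
    simp only [μ, LinearMap.mulLeft_apply]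
    exact pcmExt_generator M t k l
  calc Module.finrank K ↥(pencilSpan K (N + 1) M)
        = Module.finrank K ↥((pencilSpan K (N + 1) M).map μ) :=
          (Submodule.equivMapOfInjective μ hμ _).finrank_eq
    _ ≤ Module.finrank K ↥(pencilSpan K (N + 2) (pcmExt M)) := Submodule.finrank_mono hle

end lemmas

/-- **Monotonicity step.**  A pencil certificate of size `N + 1` and strength `B` gives one of size `N + 2`
and the same strength (block sum `M ⊕ (y₀)`, same four cells). [folklore; this crux] -/
theorem pencilCert_succ {K : Type*} [Field K] {N B : ℕ}
    (h : ∃ (M : Fin (N + 1) × Fin (N + 1) → Fin 4 → K) (c : Fin 4 → Fin (N + 1) × Fin (N + 1)),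
      IsUnit (Matrix.of fun t t' : Fin 4 => M (c t') t) ∧ B ≤ Module.finrank K ↥(pencilSpan K (N + 1) M)) :
    ∃ (M : Fin (N + 2) × Fin (N + 2) → Fin 4 → K) (c : Fin 4 → Fin (N + 2) × Fin (N + 2)),
      IsUnit (Matrix.of fun t t' : Fin 4 => M (c t') t) ∧ B ≤ Module.finrank K ↥(pencilSpan K (N + 2) M) := by
  obtain ⟨M, c, hc, hB⟩ := h
  refine ⟨pcmExt M, fun t => (Fin.castSucc (c t).1, Fin.castSucc (c t).2), ?_,
    hB.trans (pencilSpan_finrank_le_succ M)⟩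
  rw [pcmExt_cells]
  exact hc

/-- There is no certificate of size `0` (there are no cells). [trivial] -/
theorem not_pencilCert_zero {K : Type*} [Field K] {B : ℕ} :
    ¬ ∃ (M : Fin 0 × Fin 0 → Fin 4 → K) (c : Fin 4 → Fin 0 × Fin 0),
      IsUnit (Matrix.of fun t t' : Fin 4 => M (c t') t) ∧ B ≤ Module.finrank K ↥(pencilSpan K 0 M) := by
  rintro ⟨_, c, -, -⟩
  exact Fin.elim0 (c 0).1

/-- **Monotonicity in the inner size**: a certificate of size `n` and strength `B` gives one of every size
`n' ≥ n` and every strength `B' ≤ B`. [folklore; this crux] -/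
theorem pencilCert_of_le {K : Type*} [Field K] {n n' B B' : ℕ} (hnn : n ≤ n') (hBB : B' ≤ B)
    (h : ∃ (M : Fin n × Fin n → Fin 4 → K) (c : Fin 4 → Fin n × Fin n),
      IsUnit (Matrix.of fun t t' : Fin 4 => M (c t') t) ∧ B ≤ Module.finrank K ↥(pencilSpan K n M)) :
    ∃ (M : Fin n' × Fin n' → Fin 4 → K) (c : Fin 4 → Fin n' × Fin n'),
      IsUnit (Matrix.of fun t t' : Fin 4 => M (c t') t) ∧ B' ≤ Module.finrank K ↥(pencilSpan K n' M) := by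
  obtain ⟨d, rfl⟩ := Nat.exists_eq_add_of_le hnn
  induction d with
  | zero =>
    obtain ⟨M, c, hc, hB⟩ := h
    exact ⟨M, c, hc, hBB.trans hB⟩
  | succ d ih =>
    have h' := ih (Nat.le_add_right n d)
    rcases Nat.eq_zero_or_pos (n + d) with h0 | hpos
    · rw [h0] at h'
      exact absurd h' not_pencilCert_zero
    · obtain ⟨N, hN⟩ : ∃ N, n + d = N + 1 := ⟨n + d - 1, by omega⟩
      rw [show n + (d + 1) = N + 2 by omega]
      rw [hN] at h'
      exact pencilCert_succ h'

/-- **Cofinal certificates with slack suffice.**  If every large size `n` is preceded by SOME size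
`n' ≤ n` carrying a certificate of strength `≥ T n`, then every large size carries one of strength `T n`.
[this crux] -/
theorem pencilCert_eventually_of_frequently {K : Type*} [Field K] (T : ℕ → ℕ) (n₀ : ℕ)
    (h : ∀ n ≥ n₀, ∃ n' B, n' ≤ n ∧ T n ≤ B ∧
      ∃ (M : Fin n' × Fin n' → Fin 4 → K) (c : Fin 4 → Fin n' × Fin n'),
        IsUnit (Matrix.of fun t t' : Fin 4 => M (c t') t) ∧ B ≤ Module.finrank K ↥(pencilSpan K n' M)) :
    ∀ n ≥ n₀, ∃ (M : Fin n × Fin n → Fin 4 → K) (c : Fin 4 → Fin n × Fin n),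
      IsUnit (Matrix.of fun t t' : Fin 4 => M (c t') t) ∧ T n ≤ Module.finrank K ↥(pencilSpan K n M) := by
  intro n hn
  obtain ⟨n', B, hn', hT, hc⟩ := h n hn
  exact pencilCert_of_le hn' hT hc

/-- **Odd sizes suffice.**  Certificates of strength `B n` at every odd `n ≥ n₁`, and a target `T` with
`T n ≤ B n`, `T n ≤ B (n-1)` for `n ≥ n₀ ≥ n₁ + 1`, give certificates of strength `T n` at EVERY `n ≥ n₀`
(odd `n`: weaken; even `n`: the `(n-1)`-certificate ⊕ the 1×1 block). [this crux] -/
theorem pencilCert_of_odd {K : Type*} [Field K] (B T : ℕ → ℕ) (n₁ n₀ : ℕ) (h₀ : n₁ + 1 ≤ n₀)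
    (hodd : ∀ n ≥ n₁, Odd n → ∃ (M : Fin n × Fin n → Fin 4 → K) (c : Fin 4 → Fin n × Fin n),
      IsUnit (Matrix.of fun t t' : Fin 4 => M (c t') t) ∧ B n ≤ Module.finrank K ↥(pencilSpan K n M))
    (hT : ∀ n ≥ n₀, T n ≤ B n) (hT' : ∀ n ≥ n₀, T n ≤ B (n - 1)) :
    ∀ n ≥ n₀, ∃ (M : Fin n × Fin n → Fin 4 → K) (c : Fin 4 → Fin n × Fin n),
      IsUnit (Matrix.of fun t t' : Fin 4 => M (c t') t) ∧ T n ≤ Module.finrank K ↥(pencilSpan K n M) := by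
  refine pencilCert_eventually_of_frequently T n₀ fun n hn => ?_
  rcases Nat.even_or_odd n with he | ho
  · -- even: use `n - 1`, which is odd and `≥ n₁`
    have hn1 : n₁ ≤ n - 1 := by omega
    have hodd' : Odd (n - 1) := by
      obtain ⟨r, hr⟩ := he
      exact ⟨r - 1, by omega⟩
    exact ⟨n - 1, B (n - 1), Nat.sub_le n 1, hT' n hn, hodd (n - 1) hn1 hodd'⟩
  · exact ⟨n, B n, le_rfl, hT n hn, hodd n (by omega) ho⟩

/-- **`stub_fourRowPencilRank` from certificates at odd sizes** (the registered skeleton stub of line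
`four-row-count`, VERBATIM): certificates of strength `B n` at all odd `n ≥ n₁` and the two inequalities
`2⌊6n/5⌋² + ⌊6n/5⌋ + 2 ≤ B n`, `≤ B (n-1)` for `n ≥ n₀ ≥ n₁ + 1` close the per-side heart of the head
(via `fourRowPencilRank_of_pencilCertificate`). [this crux, line four-row-count] -/
theorem fourRowPencilRank_of_pencilCert_odd (B : ℕ → ℕ) (n₁ n₀ : ℕ) (h₀ : n₁ + 1 ≤ n₀)
    (hodd : ∀ n ≥ n₁, Odd n → ∃ (M : Fin n × Fin n → Fin 4 → ℂ) (c : Fin 4 → Fin n × Fin n),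
      IsUnit (Matrix.of fun t t' : Fin 4 => M (c t') t) ∧ B n ≤ Module.finrank ℂ ↥(pencilSpan ℂ n M))
    (hT : ∀ n ≥ n₀, 2 * (6 * n / 5) ^ 2 + 6 * n / 5 + 2 ≤ B n)
    (hT' : ∀ n ≥ n₀, 2 * (6 * n / 5) ^ 2 + 6 * n / 5 + 2 ≤ B (n - 1)) :
    ∃ n₀ : ℕ, ∀ n ≥ n₀, ∀ (m : ℕ) [NeZero m], n ≤ m → 5 * m ≤ 6 * n →
      ∃ g : GL (MatIdx m) ℂ, 2 * m ^ 2 + m + 2 ≤ Module.finrank ℂ ↥(Submodule.span ℂ (Set.range fun ab : {a : MatIdx m // m * m ≤ (((matIdxEquiv m).symm a : Fin (m * m)) : ℕ) + 4} × MatIdx m => (MvPolynomial.X ab.1.1 : MvPolynomial (MatIdx m) ℂ) * MvPolynomial.aeval (fun i : MatIdx m => if m * m ≤ (((matIdxEquiv m).symm i : Fin (m * m)) : ℕ) + 4 then (MvPolynomial.X i : MvPolynomial (MatIdx m) ℂ) else 0) (MvPolynomial.pderiv ab.2 (linSubst (MatIdx m) ℂ ((g : GL (MatIdx m) ℂ)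 : Matrix (MatIdx m) (MatIdx m) ℂ) (paddedPerFormLex ℂ n m))))) :=
  fourRowPencilRank_of_pencilCertificate
    ⟨n₀, pencilCert_of_odd B (fun n => 2 * (6 * n / 5) ^ 2 + 6 * n / 5 + 2) n₁ n₀ h₀ hodd hT hT'⟩

/-- **`stub_fourRowPencilRank` from certificates on any cofinal set of sizes with slack** (VERBATIM):
if every large `n` has some `n' ≤ n` with a certificate of strength `≥ 2⌊6n/5⌋² + ⌊6n/5⌋ + 2`, the stub
holds. [this crux, line four-row-count] -/
theorem fourRowPencilRank_of_pencilCert_frequently (n₀ : ℕ)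
    (h : ∀ n ≥ n₀, ∃ n' B, n' ≤ n ∧ 2 * (6 * n / 5) ^ 2 + 6 * n / 5 + 2 ≤ B ∧
      ∃ (M : Fin n' × Fin n' → Fin 4 → ℂ) (c : Fin 4 → Fin n' × Fin n'),
        IsUnit (Matrix.of fun t t' : Fin 4 => M (c t') t) ∧ B ≤ Module.finrank ℂ ↥(pencilSpan ℂ n' M)) :
    ∃ n₀ : ℕ, ∀ n ≥ n₀, ∀ (m : ℕ) [NeZero m], n ≤ m → 5 * m ≤ 6 * n →
      ∃ g : GL (MatIdx m) ℂ, 2 * m ^ 2 + m + 2 ≤ Module.finrank ℂ ↥(Submodule.span ℂ (Set.range fun ab : {a : MatIdx m // m * m ≤ (((matIdxEquiv m).symm a : Fin (m * m)) : ℕ) + 4} × MatIdx m => (MvPolynomial.X ab.1.1 : MvPolynomial (MatIdx m) ℂ) * MvPolynomial.aeval (fun i : MatIdx m => if m * m ≤ (((matIdxEquiv m).symm i : Fin (m * m)) : ℕ) + 4 then (MvPolynomial.X i : MvPolynomial (MatIdx m) ℂ) else 0) (MvPolynomial.pderiv ab.2 (linSubst (MatIdx m) ℂ ((g : GL (MatIdx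 m) ℂ) : Matrix (MatIdx m) (MatIdx m) ℂ) (paddedPerFormLex ℂ n m))))) :=
  fourRowPencilRank_of_pencilCertificate
    ⟨n₀, pencilCert_eventually_of_frequently (fun n => 2 * (6 * n / 5) ^ 2 + 6 * n / 5 + 2) n₀ h⟩

end

end Summit.ValiantsHypothesis.ValiantsHypothesis.Theorems.ValuativeFlip
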